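import Literature.NumberTheory.Transcendental.IKZAutomorphisms
import Literature.NumberTheory.Transcendental.MZVSimplexRep

/-!
# `DoubleShuffleInKZ` (stmt-KontsevichZagierPeriods-14665, route `FurushoPentagon`) ⟸ Ohno's relations, I:
# the identities of IKZ's automorphisms `Δ`, `σ`, `σ̄` on generators and on monomials

Helper file (`--supports stmt-KontsevichZagierPeriods-14665`).  The reduction of the route's
deliverable `DoubleShuffleInKZ` (regularised double shuffle inside the KZ calculus) to OHNO's
relations + DUALITY (`DualityInKZ`, proved) runs the algebra of [IharaKanekoZagier2006, §4–§6]
inside the completed free algebra `𝔥^ = ℚ⟨⟨x,y⟩⟩ = NCSeries Bool ℚ` (`false = x`, `true = y`,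
concatenation product; IKZ's formal variable `u` is absorbed into the weight grading), with the
automorphisms given by LETTER SUBSTITUTIONS (`NCSeries.subst`, `IKZ.deltaSub`, `IKZ.sigmaSub`,
`IKZ.sigmaBarSub`, `IKZ.rhoSub`, `IKZ.thetaSub`, Literature files `NCSeriesSubstitution.lean`,
`IKZAutomorphisms.lean`).  With `𝐄 = Σ y^m`, `θ : a ↦ a𝐄`, this file proves:

* `theta_delta_false/true`: `θ(Δ x) = x`, `θ(Δ y) = (1+x) y 𝐄` — hence (`theta_delta_binaryWord`)
  `θ(Δ(w_s)) = ∏ᵢ x^{kᵢ-1}(1+x) y 𝐄` for an index `s = (k₁,…,k_n)`, which is the generating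
  series of the stuffles `s ∗ 1ˡ` divided by `𝐄` (file `…OhnoStuffle`): IKZ's (4.16)
  `(1-yu)^{-1} ∗ w = (1-yu)^{-1} ш Δ_u(w)`;
* `delta_sigma_monomial`: `Δ(σ(w)) = σ̄(w)` — IKZ's Theorem 4 with (6.2) (`Δ_u = exp(Σ(-1)ⁿ∂ₙuⁿ/n)`,
  `exp(∂) = σ̄σ⁻¹`) as ONE identity of substitutions, checked on the two generators;
* `sigma_rho_monomial`: `σ(ρ(w)) = w` (`ρ = σ⁻¹` is a polynomial substitution);
* `sigmaBar_monomial_eq_dual`: `σ̄(w) = τ(σ(τ w))` with `τ = NCSeries.dualSeries not` the duality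
  anti-involution.

References: K. Ihara, M. Kaneko, D. Zagier, Compositio Math. 142 (2006), §4 (4.16)–(4.18), Cor. 3;
§6 (σ, σ̄ = τστ, Thm 3, Thm 4, (6.2)).
-/

noncomputable section

open scoped BigOperators
open Literature.NumberTheory.Transcendental NCSeries IKZ

namespace Summit.KontsevichZagierPeriods.FurushoPentagon.DoubleShuffleInKZ

variable {R : Type} [CommRing R]

/-! ## 1. `θ ∘ Δ` on the generators: the heart of IKZ's (4.16) -/

/-- `θ(1 + y) = 𝐄`. [cite: IharaKanekoZagier2006, Prop. 7] -/
theorem theta_one_add_y :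
    subst thetaSub (1 + letter true : NCSeries Bool R) = geom true 1 := by
  rw [subst_add, subst_one, subst_letter thetaSub_apply_nil, thetaSub]
  conv_rhs => rw [geom_eq_one_add true (1 : R), one_smul]

/-- `𝐄 · θ((1+y)⁻¹) = 1`. [cite: IharaKanekoZagier2006, Prop. 7] -/
theorem E_mul_theta_geom :
    geom true 1 * subst thetaSub (geom true (-1) : NCSeries Bool R) = 1 := by
  rw [← theta_one_add_y, ← subst_mul thetaSub_apply_nil, one_add_letter_mul_geom, subst_one]

/-- **`θ(Δ x) = x`.** [cite: IharaKanekoZagier2006, (4.16)–(4.18)] -/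
theorem theta_delta_false :
    subst thetaSub (deltaSub false : NCSeries Bool R) = letter false := by
  rw [deltaSub, bsub_false, subst_mul thetaSub_apply_nil, subst_letter thetaSub_apply_nil, thetaSub,
    mul_assoc, E_mul_theta_geom, mul_one]

/-- **`θ(Δ y) = (1 + x) y 𝐄`.** [cite: IharaKanekoZagier2006, (4.16)–(4.18)] -/
theorem theta_delta_true :
    subst thetaSub (deltaSub true : NCSeries Bool R) =
      (1 + letter false) * (letter true * geom true 1) := by
  rw [deltaSub, bsub_true, subst_mul thetaSub_apply_nil, subst_add, subst_one,
    ← show (deltaSub false : NCSeries Bool R) = letter false * geom true (-1) from rfl,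
    theta_delta_false, subst_letter thetaSub_apply_nil, thetaSub]

/-- The block of an entry `k ≥ 1` of an index: `x^{k-1} (1+x) y 𝐄 = θ(Δ(x^{k-1} y))`.
[cite: IharaKanekoZagier2006, (4.16)] -/
theorem theta_delta_monomial_replicate_append (k : ℕ) :
    subst thetaSub (subst deltaSub (monomial (List.replicate k false ++ [true]) 1 : NCSeries Bool R)) =
      letter false ^ k * ((1 + letter false) * (letter true * geom true 1)) := by
  rw [subst_monomial_append deltaSub_apply_nil, subst_monomial_replicate deltaSub_apply_nil,
    show (monomial [true] 1 : NCSeries Bool R) = letter true from rfl, subst_letter deltaSub_apply_nil,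
    subst_mul thetaSub_apply_nil, subst_pow thetaSub_apply_nil, theta_delta_false, theta_delta_true]

/-- **`θ(Δ(w_s)) = ∏ᵢ x^{kᵢ-1} (1+x) y 𝐄`** for the binary word `w_s = x^{k₁-1}y ⋯ x^{k_n-1}y` of an
index `s`. [cite: IharaKanekoZagier2006, (4.16)] -/
theorem theta_delta_binaryWord : ∀ s : List ℕ,
    subst thetaSub (subst deltaSub (monomial (MZV.binaryWord s) 1 : NCSeries Bool R)) =
      (s.map fun k => letter false ^ (k - 1) * ((1 + letter false) * (letter true * geom true 1))).prod
  | [] => by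
    rw [MZV.binaryWord, monomial_nil_one, subst_one, subst_one, List.map_nil, List.prod_nil]
  | a :: s => by
    rw [MZV.binaryWord, subst_monomial_append deltaSub_apply_nil, subst_mul thetaSub_apply_nil,
      theta_delta_binaryWord s, theta_delta_monomial_replicate_append, List.map_cons, List.prod_cons]

/-! ## 2. `Δ ∘ σ = σ̄` and `σ ∘ ρ = id`: IKZ's Theorem 4 with (6.2) on generators -/

/-- `Δ((1+x)⁻¹) · (1 + x(1+y)⁻¹) = 1`. [cite: IharaKanekoZagier2006, Thm 4, (6.2)] -/
theorem delta_geom_mul :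
    subst deltaSub (geom false (-1) : NCSeries Bool R) * (1 + letter false * geom true (-1)) = 1 := by
  rw [show (letter false * geom true (-1) : NCSeries Bool R) = subst deltaSub (letter false) by
      rw [subst_letter deltaSub_apply_nil]; rfl,
    ← subst_one (f := deltaSub), ← subst_add, ← subst_mul deltaSub_apply_nil, geom_mul_one_add_letter,
    subst_one]

/-- **`Δ(σ a) = σ̄ a` on the two letters.** [cite: IharaKanekoZagier2006, Thm 4, (6.2)] -/
theorem delta_sigmaSub (a : Bool) :
    subst deltaSub (sigmaSub a : NCSeries Bool R) = sigmaBarSub a := by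
  cases a with
  | false => rw [sigmaSub, bsub_false, subst_letter deltaSub_apply_nil]; rfl
  | true =>
    rw [sigmaSub, bsub_true, subst_mul deltaSub_apply_nil, subst_letter deltaSub_apply_nil, deltaSub,
      bsub_true, ← mul_assoc, ← show (deltaSub : Bool → NCSeries Bool R) = bsub (letter false * geom true (-1))
        ((1 + letter false * geom true (-1)) * letter true) from rfl, delta_geom_mul, one_mul]
    rfl

/-- **`Δ(σ(w)) = σ̄(w)` on every monomial** (hence on all of `𝔥`): IKZ's Theorem 4
(`Δ_u = exp(Σₙ (-1)ⁿ ∂ₙ uⁿ/n)`) combined with (6.2) (`exp(∂) = σ̄ σ⁻¹`), as one identity of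
continuous algebra endomorphisms. [cite: IharaKanekoZagier2006, Thm 4, (6.2)] -/
theorem delta_sigma_monomial : ∀ w : List Bool,
    subst deltaSub (subst sigmaSub (monomial w 1 : NCSeries Bool R)) = subst sigmaBarSub (monomial w 1)
  | [] => by rw [monomial_nil_one, subst_one, subst_one, subst_one]
  | a :: w => by
    rw [subst_monomial_cons sigmaSub_apply_nil, subst_mul deltaSub_apply_nil, delta_sigma_monomial w,
      delta_sigmaSub, subst_monomial_cons sigmaBarSub_apply_nil]

/-- **`σ(ρ a) = a` on the two letters** (`ρ = σ⁻¹`). [cite: IharaKanekoZagier2006, §6 (σ)] -/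
theorem sigma_rhoSub (a : Bool) : subst sigmaSub (rhoSub a : NCSeries Bool R) = letter a := by
  cases a with
  | false => rw [rhoSub, bsub_false, subst_letter sigmaSub_apply_nil]; rfl
  | true =>
    rw [rhoSub, bsub_true, subst_mul sigmaSub_apply_nil, subst_add, subst_one,
      subst_letter sigmaSub_apply_nil, subst_letter sigmaSub_apply_nil, sigmaSub, bsub_false, bsub_true,
      ← mul_assoc, one_add_letter_mul_geom, one_mul]

/-- **`σ(ρ(w)) = w` on every monomial.** [cite: IharaKanekoZagier2006, §6 (σ)] -/
theorem sigma_rho_monomial : ∀ w : List Bool,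
    subst sigmaSub (subst rhoSub (monomial w 1 : NCSeries Bool R)) = monomial w 1
  | [] => by rw [monomial_nil_one, subst_one, subst_one]
  | a :: w => by
    rw [subst_monomial_cons rhoSub_apply_nil, subst_mul sigmaSub_apply_nil, sigma_rho_monomial w,
      sigma_rhoSub, monomial_cons_eq_letter_mul]

/-! ## 3. `σ̄ = τ σ τ` -/

/-- `τ(σ(!a)) = σ̄(a)` on the two letters. [cite: IharaKanekoZagier2006, §6 (σ̄ = τστ)] -/
theorem dual_sigmaSub_not (a : Bool) :
    dualSeries (fun b => !b) (sigmaSub (!a) : NCSeries Bool R) = sigmaBarSub a := by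
  cases a with
  | false =>
    rw [Bool.not_false, sigmaSub, bsub_true, dualSeries_mul, dualSeries_letter, dualSeries_geom]
    rfl
  | true =>
    rw [Bool.not_true, sigmaSub, bsub_false, dualSeries_letter]
    rfl

/-- **`σ̄(w) = τ(σ(τ w))` on every monomial**, `τ w` = `w` reversed with the letters exchanged.
[cite: IharaKanekoZagier2006, §6 (σ̄ = τστ)] -/
theorem sigmaBar_monomial_eq_dual : ∀ w : List Bool,
    subst sigmaBarSub (monomial w 1 : NCSeries Bool R) =
      dualSeries (fun b => !b) (subst sigmaSub (monomial ((w.reverse).map fun b => !b) 1))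
  | [] => by rw [List.reverse_nil, List.map_nil, monomial_nil_one, subst_one, subst_one, dualSeries_one]
  | a :: w => by
    rw [List.reverse_cons, List.map_append, List.map_singleton, subst_monomial_append sigmaSub_apply_nil,
      dualSeries_mul, ← sigmaBar_monomial_eq_dual w, show (monomial [!a] 1 : NCSeries Bool R) = letter (!a)
        from rfl, subst_letter sigmaSub_apply_nil, dual_sigmaSub_not, subst_monomial_cons sigmaBarSub_apply_nil]

/-! ## 4. Polynomials are finite sums of monomials; `Δ(w) = σ̄(v)`, `w = σ(v)` with `v = ρ(w)` -/

/-- A series vanishing above weight `M` is the finite sum of its monomials. [folklore] -/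
theorem eq_sum_wordsLE_smul_monomial {φ : NCSeries Bool R} {M : ℕ}
    (h : ∀ u : List Bool, M < u.length → φ u = 0) :
    φ = ∑ u ∈ wordsLE Bool M, φ u • monomial u 1 := by
  funext v
  rw [finset_sum_apply]
  simp only [NCSeries.smul_apply, monomial_apply, smul_eq_mul, mul_ite, mul_one, mul_zero]
  rw [Finset.sum_ite_eq]
  split_ifs with hv
  · rfl
  · rw [mem_wordsLE, not_le] at hv
    exact h v hv

/-- Weight bound for products: if `φ` lives in weight `≤ p` and `ψ` in weight `≤ q` then `φ ψ` lives
in weight `≤ p + q`. [folklore] -/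
theorem mul_apply_eq_zero_of_length_lt {φ ψ : NCSeries Bool R} {p q : ℕ}
    (hφ : ∀ u : List Bool, p < u.length → φ u = 0) (hψ : ∀ u : List Bool, q < u.length → ψ u = 0)
    (u : List Bool) (hu : p + q < u.length) : (φ * ψ) u = 0 := by
  rw [mul_apply]
  refine Finset.sum_eq_zero fun c hc => ?_
  have hl := congrArg List.length (mem_splits.mp hc)
  rw [List.length_append] at hl
  by_cases h1 : p < c.1.length
  · rw [hφ _ h1, zero_mul]
  · rw [hψ _ (by omega), mul_zero]

/-- The letter images of `ρ` live in weight `≤ 2`. [cite: IharaKanekoZagier2006, §6 (σ)] -/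
theorem rhoSub_apply_eq_zero (a : Bool) (u : List Bool) (hu : 2 < u.length) :
    (rhoSub a : NCSeries Bool R) u = 0 := by
  obtain ⟨b, c, d, u, rfl⟩ : ∃ b c d u', u = b :: c :: d :: u' := by
    match u, hu with
    | b :: c :: d :: u', _ => exact ⟨b, c, d, u', rfl⟩
  cases a with
  | false => rw [rhoSub, bsub_false, letter_apply, if_neg (by simp)]
  | true =>
    rw [rhoSub, bsub_true, add_mul, one_mul, NCSeries.add_apply, letter_apply, if_neg (by simp), zero_add,
      letter_mul_apply_cons]
    split_ifs
    · rw [letter_apply, if_neg (by simp)]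
    · rfl

/-- `ρ(w)` is a polynomial living in weight `≤ 2|w|`. [cite: IharaKanekoZagier2006, §6 (σ)] -/
theorem rho_monomial_apply_eq_zero : ∀ (w u : List Bool), 2 * w.length < u.length →
    subst rhoSub (monomial w 1 : NCSeries Bool R) u = 0
  | [], u, hu => by
    rw [monomial_nil_one, subst_one]
    cases u with
    | nil => simp at hu
    | cons b u => rfl
  | a :: w, u, hu => by
    rw [subst_monomial_cons rhoSub_apply_nil]
    exact mul_apply_eq_zero_of_length_lt (p := 2) (q := 2 * w.length) (rhoSub_apply_eq_zero a)
      (rho_monomial_apply_eq_zero w) u (by rw [List.length_cons] at hu; omega)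

/-- `ρ(w)` as the finite sum of its monomials. [cite: IharaKanekoZagier2006, §6 (σ)] -/
theorem rho_monomial_eq_sum (w : List Bool) :
    subst rhoSub (monomial w 1 : NCSeries Bool R) =
      ∑ u ∈ wordsLE Bool (2 * w.length),
        subst rhoSub (monomial w 1 : NCSeries Bool R) u • (monomial u 1 : NCSeries Bool R) :=
  eq_sum_wordsLE_smul_monomial (rho_monomial_apply_eq_zero w)

/-- **`Δ(w) = Σ_u c_u(ρ w) σ̄(u)`**: `Δ = σ̄ ∘ ρ` expanded on the monomials of `ρ(w)` — IKZ's
Theorem 4 with (6.2) in the form `Δ σ = σ̄`, `σ ρ = 1`. [cite: IharaKanekoZagier2006, Thm 4, (6.2)] -/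
theorem delta_monomial_eq_sum_sigmaBar (w : List Bool) :
    subst deltaSub (monomial w 1 : NCSeries Bool R) =
      ∑ u ∈ wordsLE Bool (2 * w.length),
        subst rhoSub (monomial w 1 : NCSeries Bool R) u •
          subst sigmaBarSub (monomial u 1 : NCSeries Bool R) := by
  conv_lhs => rw [← sigma_rho_monomial w, rho_monomial_eq_sum, subst_finset_sum, subst_finset_sum]
  refine Finset.sum_congr rfl fun u _ => ?_
  rw [subst_smul, subst_smul, delta_sigma_monomial]

/-- **`w = Σ_u c_u(ρ w) σ(u)`**: `σ ∘ ρ = 1` expanded on the monomials of `ρ(w)`.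
[cite: IharaKanekoZagier2006, §6 (σ)] -/
theorem monomial_eq_sum_sigma (w : List Bool) :
    (monomial w 1 : NCSeries Bool R) =
      ∑ u ∈ wordsLE Bool (2 * w.length),
        subst rhoSub (monomial w 1 : NCSeries Bool R) u •
          subst sigmaSub (monomial u 1 : NCSeries Bool R) := by
  conv_lhs => rw [← sigma_rho_monomial w, rho_monomial_eq_sum, subst_finset_sum]
  refine Finset.sum_congr rfl fun u _ => ?_
  rw [subst_smul]

/-! ## 5. Coefficients behind a prefix `x^k y` -/

/-- The coefficient of `x^k y · φ` on a word: `c_w(x^k y φ) = [w = x^k y w'] c_{w'}(φ)`. [folklore] -/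
theorem pow_x_mul_y_mul_apply (φ : NCSeries Bool ℚ) (k : ℕ) (w : List Bool) :
    ((letter false : NCSeries Bool ℚ) ^ k * letter true * φ : NCSeries Bool ℚ) w =
      if List.replicate k false ++ [true] <+: w then φ (w.drop (k + 1)) else 0 := by
  induction k generalizing w with
  | zero =>
    rw [pow_zero, one_mul, List.replicate_zero, List.nil_append]
    cases w with
    | nil => rw [letter_mul_apply_nil, if_neg (by simp)]
    | cons b w =>
      rw [letter_mul_apply_cons, zero_add, List.drop_one, List.tail_cons]
      by_cases hb : b = true
      · subst hb; simp
      · rw [if_neg hb, if_neg (by simp [hb])]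
  | succ k ih =>
    rw [pow_succ', mul_assoc, mul_assoc, ← mul_assoc ((letter false : NCSeries Bool ℚ) ^ k)]
    cases w with
    | nil => rw [letter_mul_apply_nil, if_neg (by simp)]
    | cons b w =>
      rw [letter_mul_apply_cons, List.replicate_succ, List.cons_append]
      by_cases hb : b = false
      · subst hb
        rw [if_pos rfl, ih w, List.drop_succ_cons]
        simp [List.cons_prefix_cons]
      · rw [if_neg hb, if_neg (by simp [List.cons_prefix_cons, hb])]

end Summit.KontsevichZagierPeriods.FurushoPentagon.DoubleShuffleInKZ
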